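import Summits.BirchSwinnertonDyer.BirchSwinnertonDyer.Theorems.ByReductionTypeAtTwoOrdKatoHalfAtTwoIsoPosDiscDefs
import HarnessLib

/-!
# Route ByReductionTypeAtTwo, crux `OrdKatoHalfAtTwoIso` (stmt-BirchSwinnertonDyer-19573), line `steinberg-fibre-at-two`:
# the SPLIT-GLUE DOOR of package P8′ — the crux BY NAME from F1μι⁻ (`Δ < 0`), the direct `0 < Δ` child, the print bundle and B7′

Seat `cruxlead-stmt-BirchSwinnertonDyer-19573-g5` (LEAD PROVER, MODE LINE; HOME `run/shared/lean/pub/bsd-2adic/`; pen RC-389 (3) «lead: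
`…ordKatoHalfAtTwoIso_of_iota_halves hNeg hPos … hBundle hB7`»). THEOREMS ONLY (no definition, no named fact, no `sorry`, no instance).
HONEST FRAMING (cell bsd-2adic): BSD is not proved by any of this; the crux `OrdKatoHalfAtTwoIso` is NOT proved here — every theorem below
is CONDITIONAL on displayed OPEN statements (`ZetaColemanMuIotaNegDiscAtTwo`, `OrdKatoHalfAtTwoIsoPosDisc`, the print bundle, B7′/B7).
What is UNCONDITIONAL inside: the core Theorem A at `2` on `Δ < 0` (`coreTheoremATwoResidue_holds`, p669276), `μ_an = 0` and INT2-AUTO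
(tree), Abbes–Ullmo ⇒ `ord₂ ϖ = 0` on the good `E[2]`-irreducible locus (p654400), w3's per-datum ι-door (p690167).

THE TRICHOTOMY at a non-CM good-ordinary analytic-rank-`0` curve `W` (the composition `OrdKatoHalfAtTwoIso_of` of skeleton v13):
* `ρ̄_{W,2}` NOT onto ⇒ B7 (Kato-optimal member; from B7′ + Greenberg 5.14@2, p679274) ⇒ an isogenous `W′` (p-tree `…_of_binder`);
* `ρ̄_{W,2}` onto, `Δ_W < 0` ⇒ F1μι⁻ per datum + the PROVED core on `Δ < 0` ⇒ `μ(X) = 0` for every datum (w3's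
  `mu_eq_zero_of_zetaColemanMuIota_of_negDisc`) ⇒ Kato's `μ`-part ⇒ with Abbes–Ullmo and Kato 17.4 (1)(2) at `W` the integral lower
  divisibility AT `W` (`O1.mainConjectureLowerDivisibilityAtTwoOrd_of_katoMuPartAtTwo`), `W′ := W`;
* `ρ̄_{W,2}` onto, `0 < Δ_W` ⇒ the direct child `OrdKatoHalfAtTwoIsoPosDisc` («no mechanism yet»).
CoreA⁺ (`CoreTheoremAPosDiscTwo`, PROVED p691138) is deliberately NOT in the cone: on `0 < Δ` its premise has no Kato witness (F-27a).

References: K. Kato, Astérisque 295 (2004) Thm. 17.4, §17.13 [Kato2004Asterisque]; R. Greenberg, LNM 1716 (1999) Conj. 1.11, Prop. 5.14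
[GreenbergLNM1716]; A. Abbes, E. Ullmo, Compositio 103 (1996) Thm. A [AbbesUllmo1996]; tree p669276, p679274, p684479, p690167, p691807,
`…PosDiscDefs` (this seat).
-/

set_option autoImplicit false
set_option linter.dupNamespace false

noncomputable section

open scoped Classical MatrixGroups ModularForm NumberField
open CongruenceSubgroup WeierstrassCurve Field IsDedekindDomain NumberField
open Literature.NumberTheory.GaloisRepresentations
open Literature.NumberTheory.GaloisCohomology
open Literature.NumberTheory.EllipticCurves Literature.NumberTheory.EllipticCurves.ModularForms
open Literature.NumberTheory.EllipticCurves.Kato2004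
  Literature.NumberTheory.EllipticCurves.Kato2004.EulerSystemValues
open Literature.NumberTheory.EllipticCurves.Rank1Residual
open Literature.NumberTheory.EllipticCurves.Greenberg1999
open Summit.BirchSwinnertonDyer.BirchSwinnertonDyer.Theorems.Rank1ResidualX1Defs
  Summit.BirchSwinnertonDyer.BirchSwinnertonDyer.Rank1Residual
  Summit.BirchSwinnertonDyer.BirchSwinnertonDyer.Rank1Residual.CoreAssembly
open Summit.BirchSwinnertonDyer.Rank1Residual Summit.BirchSwinnertonDyer.Rank1Residual.X5
open Summit.BirchSwinnertonDyer.BirchSwinnertonDyer.Theorems.OrdKatoOptimalAtTwo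
  Summit.BirchSwinnertonDyer.BirchSwinnertonDyer.Theorems.OrdKatoIntAtTwo
open Summit.BirchSwinnertonDyer.BirchSwinnertonDyer.Theses.ByReductionTypeAtTwo

namespace Summit.BirchSwinnertonDyer.BirchSwinnertonDyer.Theorems.SteinbergFibreAtTwo

/-! ## §1 The `Δ < 0` cell from F1μι⁻ (per curve) -/

/-- **`μ(X(E/ℚ_∞)) = 0` for every cyclotomic Selmer dual datum at a curve of the cell [good ordinary at `2`, `ρ̄₂` onto, `Δ < 0`],
modulo F1μι⁻ only** — the core Theorem A at `2` on `Δ < 0` is the THEOREM p669276 (inside w3's per-datum ι-door).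
[cite: Kato2004Asterisque, §17.13 (pp. 279–280)] [cite: GreenbergLNM1716, Conj. 1.11 (p. 64) (shape)] -/
theorem mu_eq_zero_of_iotaNegDisc (hNeg : ZetaColemanMuIotaNegDiscAtTwo)
    (W : WeierstrassCurve ℚ) [W.IsElliptic] [W.IsGloballyMinimal]
    (hgo : GoodOrd W 2) (h2 : W.HasSurjectiveModNGaloisRep 2) (hΔ : W.Δ < 0)
    {N : ℕ} [NeZero N] (f : CuspForm (Gamma0 N) 2) (hf : IsNewformOf W f)
    (κ : ZpExtension ℚ 2) (γ : absoluteGaloisGroup ℚ) (hκ : κ.IsCyclotomic) (hγ : κ.IsTopGenerator γ)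
    (hγ' : IsCyclotomicVariable 2 γ) (D : W.SelmerDualData κ γ) : D.mu = 0 := by
  haveI : ContinuousSMul ℤ_[2] (W.tateModule 2) := TateModule.continuousSMul_padicInt
  haveI : Module.Free ℤ_[2] (W.tateModule 2) := W.module_free_tateModule_holds 2
  haveI : Module.Finite ℤ_[2] (W.tateModule 2) := W.module_finite_tateModule_holds 2
  obtain ⟨Y⟩ := W.nonempty_fineSelmerDualData κ hγ
  obtain ⟨I, Z, P, ℓ, τ, π, hZ, hτℓ, hπs, hπ, himg⟩ := hNeg W f κ γ hκ ⟨hgo.1, hgo.2⟩ h2 hΔ hγ hγ' hf D Y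
  exact mu_eq_zero_of_zetaColemanMuIota_of_negDisc hgo h2 hΔ hf hγ _ I Z P ℓ τ π hZ hτℓ hπs hπ himg

/-- **Kato's `μ`-part `O1.KatoMuPartAtTwo W` on the cell [good ordinary at `2`, `ρ̄₂` onto, `Δ < 0`], modulo F1μι⁻**
(`μ = 0 ⇒ 2^μ = 1 ∣ L₀`). [cite: GreenbergLNM1716, Conj. 1.11 (p. 64) (shape)] -/
theorem katoMuPartAtTwo_of_iotaNegDisc (hNeg : ZetaColemanMuIotaNegDiscAtTwo)
    (W : WeierstrassCurve ℚ) [W.IsElliptic] [W.IsGloballyMinimal]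
    (hgo : GoodOrd W 2) (h2 : W.HasSurjectiveModNGaloisRep 2) (hΔ : W.Δ < 0) :
    O1.KatoMuPartAtTwo W := by
  intro κ γ hκ hγ hγ' _ _ f hf ϖ _ D L₀ _
  rw [mu_eq_zero_of_iotaNegDisc hNeg W hgo h2 hΔ f hf κ γ hκ hγ hγ' D, pow_zero, map_one]
  exact one_dvd _

/-- **Kato's integral lower divisibility `X5.O1.MainConjectureLowerDivisibilityAtTwoOrd W` AT a curve of the cell [good ordinary at
`2`, `ρ̄₂` onto, `Δ < 0`], modulo F1μι⁻, Abbes–Ullmo BY NAME and Kato 17.4 (1)(2) at `W` (PRINT).**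
[cite: Kato2004Asterisque, Thm. 17.4 (1)(2) (p. 273)] [cite: AbbesUllmo1996, Thm. A] -/
theorem mainConjectureLowerDivisibilityAtTwoOrd_of_iotaNegDisc (hNeg : ZetaColemanMuIotaNegDiscAtTwo)
    (W : WeierstrassCurve ℚ) [W.IsElliptic] [W.IsGloballyMinimal]
    (hAU : abbesUllmo_not_dvd_maninConstant_of_not_dvd_level)
    (hgo : GoodOrd W 2) (h2 : W.HasSurjectiveModNGaloisRep 2) (hΔ : W.Δ < 0)
    (h17 : ∀ [NeZero (W.conductorNorm ℤ)] (f : CuspForm (Gamma0 (W.conductorNorm ℤ)) 2),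
      kato_divisibility_allPrimes W 2 (f := f)) :
    O1.MainConjectureLowerDivisibilityAtTwoOrd W := by
  haveI : NeZero ((2 : ℕ) : ℚ) := ⟨by norm_num⟩
  exact O1.mainConjectureLowerDivisibilityAtTwoOrd_of_katoMuPartAtTwo W h17
    (fun f hf ϖ hϖ => hint_two_of_abbesUllmo_of_irr hAU W hgo
      (hasIrreducibleModPGaloisRep_of_hasSurjectiveModNGaloisRep W 2 h2) f hf ϖ hϖ)
    (katoMuPartAtTwo_of_iotaNegDisc hNeg W hgo h2 hΔ)


/-- **The residue binder `OrdKatoHalfDD12ResidueTwo` (23888-type «`ρ̄₂` onto, `ρ_{2^∞}` not onto») from F1μι⁻ ALONE + Abbes–Ullmo +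
Kato 17.4 (1)(2) at `2`** — the residue lies inside the `Δ < 0` cell (Dokchitser–Dokchitser, `Δ_neg_of_residue'`, p-tree), where the core
Theorem A at `2` is PROVED. [cite: DokchitserDokchitserMathZ2012, Theorem (2)] [cite: Kato2004Asterisque, Thm. 17.4 (1)(2) (p. 273)] -/
theorem ordKatoHalfDD12ResidueTwo_of_iotaNegDisc (hNeg : ZetaColemanMuIotaNegDiscAtTwo)
    (hAU : abbesUllmo_not_dvd_maninConstant_of_not_dvd_level)
    (h17 : ∀ (V : WeierstrassCurve ℚ) [V.IsElliptic] [V.IsGloballyMinimal] [NeZero (V.conductorNorm ℤ)]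
      (f : CuspForm (Gamma0 (V.conductorNorm ℤ)) 2), kato_divisibility_allPrimes V 2 (f := f)) :
    OrdKatoHalfDD12ResidueTwo :=
  fun W _ _ _ hgo h2 hns =>
    mainConjectureLowerDivisibilityAtTwoOrd_of_iotaNegDisc hNeg W hAU hgo h2 (Δ_neg_of_residue' W hgo h2 hns) (h17 W)

/-! ## §2 The trichotomy: the crux BY NAME -/

/-- **The `∃`-member form at EVERY non-CM good-ordinary analytic-rank-`0` curve** from F1μι⁻ (`Δ < 0` cell), the direct `0 < Δ` child,
B7 (the `ρ̄₂`-not-onto locus) and Kato 17.4 (1)(2) at `2` — the sign/image TRICHOTOMY (`Δ_W ≠ 0` for an elliptic curve).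
[cite: Kato2004Asterisque, Thm. 17.4 (1)(2) (p. 273)] [cite: AbbesUllmo1996, Thm. A] -/
theorem exists_isIsogenous_mainConjectureLowerDivisibilityAtTwoOrd_of_iota_halves
    (hNeg : ZetaColemanMuIotaNegDiscAtTwo) (hPos : OrdKatoHalfAtTwoIsoPosDisc)
    (hAU : abbesUllmo_not_dvd_maninConstant_of_not_dvd_level) (hB7 : KatoMuPartAtOptimalMemberOfNotSurjectiveTwo)
    (h17 : ∀ (V : WeierstrassCurve ℚ) [V.IsElliptic] [V.IsGloballyMinimal] [NeZero (V.conductorNorm ℤ)]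
      (f : CuspForm (Gamma0 (V.conductorNorm ℤ)) 2), kato_divisibility_allPrimes V 2 (f := f))
    (W : WeierstrassCurve ℚ) [W.IsElliptic] [W.IsGloballyMinimal]
    (hcm : ¬ W.HasCM) (hr : W.analyticRank = 0) (hgo : GoodOrd W 2) :
    ∃ (W' : WeierstrassCurve ℚ) (_ : W'.IsElliptic) (_ : W'.IsGloballyMinimal),
      IsIsogenous W W' ∧ O1.MainConjectureLowerDivisibilityAtTwoOrd W' := by
  by_cases him : W.HasSurjectiveModNGaloisRep 2
  · rcases lt_or_gt_of_ne W.isUnit_Δ.ne_zero with hΔ | hΔ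
    · exact ⟨W, ‹_›, ‹_›, isIsogenous_self W,
        mainConjectureLowerDivisibilityAtTwoOrd_of_iotaNegDisc hNeg W hAU hgo him hΔ (h17 W)⟩
    · exact hPos W hcm hr hgo him hΔ
  · exact exists_isIsogenous_mainConjectureLowerDivisibilityAtTwoOrd_of_binder W hB7 h17 hcm hgo him

/-- **The crux `OrdKatoHalfAtTwoIso` BY NAME from F1μι⁻, the direct `0 < Δ` child, Abbes–Ullmo, B7 and Kato 17.4 (1)(2) at `2`.**
CONDITIONAL on the displayed hypotheses; nothing closed. [cite: Kato2004Asterisque, Thm. 17.4 (1)(2) (p. 273)] [cite: AbbesUllmo1996, Thm. A] -/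
theorem ordKatoHalfAtTwoIso_of_iota_halves_B7
    (hNeg : ZetaColemanMuIotaNegDiscAtTwo) (hPos : OrdKatoHalfAtTwoIsoPosDisc)
    (hAU : abbesUllmo_not_dvd_maninConstant_of_not_dvd_level) (hB7 : KatoMuPartAtOptimalMemberOfNotSurjectiveTwo)
    (h17 : ∀ (V : WeierstrassCurve ℚ) [V.IsElliptic] [V.IsGloballyMinimal] [NeZero (V.conductorNorm ℤ)]
      (f : CuspForm (Gamma0 (V.conductorNorm ℤ)) 2), kato_divisibility_allPrimes V 2 (f := f)) :
    OrdKatoHalfAtTwoIso :=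
  fun W _ _ hcm hr hgo =>
    exists_isIsogenous_mainConjectureLowerDivisibilityAtTwoOrd_of_iota_halves hNeg hPos hAU hB7 h17 W hcm hr hgo

/-- **P8′ SPLIT GLUE SHAPE — the crux `OrdKatoHalfAtTwoIso` BY NAME from its post-P8′ children**: F1μι⁻
(`ZetaColemanMuIotaNegDiscAtTwo`, the re-keyed and `Δ < 0`-restricted child 23959), the direct `0 < Δ` child
(`OrdKatoHalfAtTwoIsoPosDisc`), the print bundle `PUB ∧ Abbes–Ullmo ∧ Greenberg 5.14@2` (child 23889) and the re-cut B7′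
(`KatoMuPartOff514AtOptimalMemberOfNotSurjectiveTwo`, child 23921; B7′ + 5.14@2 ⇒ B7 by `katoMuPartAtOptimalMember_of_prop514_of_off514`,
p679274). Child 23967 (CoreA⁺, CLOSED) is not in the cone. CONDITIONAL; nothing closed.
[cite: Kato2004Asterisque, Thm. 17.4 (1)(2) (p. 273)] [cite: GreenbergLNM1716, Prop. 5.14 (p. 130)] [cite: AbbesUllmo1996, Thm. A] -/
theorem ordKatoHalfAtTwoIso_of_iota_halves
    (hNeg : ZetaColemanMuIotaNegDiscAtTwo) (hPos : OrdKatoHalfAtTwoIsoPosDisc)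
    (hbundle : OrdPublishedInputsAtTwo ∧ abbesUllmo_not_dvd_maninConstant_of_not_dvd_level ∧
      Greenberg1999.prop514_isTorsion_mu_eq_zero_two)
    (hB7' : KatoMuPartOff514AtOptimalMemberOfNotSurjectiveTwo) : OrdKatoHalfAtTwoIso := by
  obtain ⟨hPub, hAU, h514⟩ := hbundle
  obtain ⟨_, _, h17, _⟩ := hPub
  exact ordKatoHalfAtTwoIso_of_iota_halves_B7 hNeg hPos hAU
    (katoMuPartAtOptimalMember_of_prop514_of_off514 h514 hB7') h17

/-- **The same door with the `0 < Δ` child replaced by the whole crux's monotone image is a tautology check** (sanity: the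
direct child is implied by the crux, `ordKatoHalfAtTwoIsoPosDisc_of_ordKatoHalfAtTwoIso`), and with F1μι⁻ obtained from the
sign-free ι-supply (monotonicity `zetaColemanMuIotaNegDiscAtTwo_of_iota_signFree`): the P8′ cone is implied by the v12 cone.
[folklore] -/
theorem ordKatoHalfAtTwoIso_of_iota_signFree_of_posDisc
    (hZι : ∀ (W : WeierstrassCurve ℚ) [W.IsElliptic] [W.IsGloballyMinimal]
      [ContinuousSMul ℤ_[2] (W.tateModule 2)] [Module.Free ℤ_[2] (W.tateModule 2)]
      [Module.Finite ℤ_[2] (W.tateModule 2)] {N : ℕ} [NeZero N] (f : CuspForm (Gamma0 N) 2)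
      (κ : ZpExtension ℚ 2) (γ : absoluteGaloisGroup ℚ) (hκ : κ.IsCyclotomic),
      IsOrdinaryAt W 2 → W.HasSurjectiveModNGaloisRep 2 →
      κ.IsTopGenerator γ → IsCyclotomicVariable 2 γ → IsNewformOf W f →
      ∀ (D : W.SelmerDualData κ γ) (Y : W.FineSelmerDualData κ γ),
        ∃ (I : IwasawaH1Data W 2 κ γ)
          (Z : Submodule (IwasawaAlgebra 2) I.H) (P : Submodule (IwasawaAlgebra 2) (IwasawaAlgebra 2))
          (ℓ : I.H →ₗ[IwasawaAlgebra 2] P)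
          (τ : P →ₛₗ[((IwasawaAlgebra.involEquiv 2).toRingEquiv : IwasawaAlgebra 2 →+* IwasawaAlgebra 2)] D.X)
          (π : D.X →ₗ[IwasawaAlgebra 2] Y.X),
          Z ≤ Submodule.span (IwasawaAlgebra 2) {s : I.H | IsEulerSystemClassTwo W hκ I s} ∧
          (∀ z ∈ Z, τ (ℓ z) = 0) ∧ Function.Surjective π ∧ Function.Exact τ π ∧
          ∀ G₁ : IwasawaAlgebra 2,
            iwasawaToPowerSeries 2 G₁ = padicLFunction f (unitRoot W 2 : ℚ_[2]) →
              ∃ s : IwasawaAlgebra 2, s ∉ IwasawaAlgebra.augIdealP 2 ∧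
                s * G₁ ∈ Submodule.map (P.subtype ∘ₗ ℓ) Z)
    (hPos : OrdKatoHalfAtTwoIsoPosDisc)
    (hbundle : OrdPublishedInputsAtTwo ∧ abbesUllmo_not_dvd_maninConstant_of_not_dvd_level ∧
      Greenberg1999.prop514_isTorsion_mu_eq_zero_two)
    (hB7' : KatoMuPartOff514AtOptimalMemberOfNotSurjectiveTwo) : OrdKatoHalfAtTwoIso :=
  ordKatoHalfAtTwoIso_of_iota_halves (zetaColemanMuIotaNegDiscAtTwo_of_iota_signFree hZι) hPos hbundle hB7'

end Summit.BirchSwinnertonDyer.BirchSwinnertonDyer.Theorems.SteinbergFibreAtTwo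

end
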